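import Literature.Probability.Percolation.IsoradialRectangularLoopsBridge
import Literature.Probability.Percolation.InterfaceLoopWindingSign
import HarnessLib

/-!
# Partner loops of the same type wind equally around points away from their traces

Topic: Probability / Percolation (the loop representation of critical bond percolation on `ℤ²`
and DKKMO's relation `d_CN(F, F') ≤ ε`: Duminil-Copin–Kozlowski–Krachun–Manolescu–Oulamara,
arXiv:2012.11672v2 (2026), §1.2, eq. (1) and the display before it — every loop of `F` in the
window has a loop OF THE SAME TYPE in `F'` at unoriented reparametrised distance `d ≤ ε`).

The distance `d` of eq. (1) (`UnbasedLoop.udist`) ignores orientations, so an `ε`-matching of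
two loops may reverse the orientation, and then winding numbers are matched up to sign
(`UnbasedLoop.wind_eq_or_eq_neg_of_udist_lt`).  For the loops of the loop representation the
TYPE restores the sign: interface loops of `ℤ²` of type `1` (exterior boundaries of primal
clusters) wind non-negatively around every point and those of type `0` non-positively
(`InterfaceLoopWindingSign`: `IsInterfaceLoop.loopType_sign_mul_wind_nonneg`, at mesh `1`),
at every mesh and every rotation of the lattice (`loopType_sign_mul_wind_loopCurve_nonneg`,
through `wind_loopCurve`).  Hence (`IsInterfaceLoop.wind_eq_of_udist_le`): **if two interface
loops `γ` (of `ω`, drawn on `δe^{iβ}ℤ²`) and `γ'` (of `ω'`, drawn on `δe^{iβ'}ℤ²`) have the same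
type, `d(γ, γ') ≤ ε`, and `γ` is fat at scale `ε` (it winds around some point at distance
`> ε` from its trace), then `W(γ', z) = W(γ, z)` for every `z` at distance `> ε` from the trace
of `γ`** — the oriented distance is already `≤ ε` (`UnbasedLoop.dist_le_of_udist_le`, the
orientation lemma of `LoopWinding`), and winding numbers are stable under oriented
`ε`-perturbations away from the trace (`UnbasedLoop.wind_eq_of_dist_lt`).

This is the form in which `d_CN`-closeness of the loop representations of two configurations
(`LoopConfig.IsClose`) transfers "inside / outside" information between partner loops.

## References

* H. Duminil-Copin, K. K. Kozlowski, D. Krachun, I. Manolescu, M. Oulamara, arXiv:2012.11672v2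
  (2026), §1.2 (types, `d`, `d_CN`) [arXiv201211672v2].
* F. Camia, C. M. Newman, Comm. Math. Phys. 268 (2006), §4 (oriented cluster boundaries)
  [CamiaNewman2006].
-/

noncomputable section

open Set Metric
open Literature.Probability.LatticeModels Literature.Probability.RandomPlanarGeometry

namespace Literature.Probability.Percolation

variable {ω ω' : BondConfig (Site 2)} {γ γ' : List MedialVertex}

/-- **Sign of the winding numbers at every mesh and rotation.** For an interface loop `γ` of
type `i` drawn on `δ e^{iβ} ℤ²` (`δ ≠ 0`), `0 ≤ s(i) · W(loopCurve δ β γ, z)` for every `z`, with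
`s(1) = 1`, `s(0) = -1` (type-`1` loops wind counter-clockwise, type-`0` loops clockwise).
[cite: arXiv201211672v2, §1.2] -/
theorem IsInterfaceLoop.loopType_sign_mul_wind_loopCurve_nonneg (h : IsInterfaceLoop ω γ) {δ : ℝ}
    (hδ : δ ≠ 0) (β : ℝ) (z : ℂ) :
    0 ≤ (![-1, 1] : Fin 2 → ℤ) (loopType γ) * (loopCurve δ β γ).wind z := by
  set w : ℂ := ((rotation (Circle.exp β)).symm z) / δ with hw
  have hz : z = rotation (Circle.exp β) ((δ : ℂ) * w) := by
    rw [hw, mul_div_cancel₀ _ (Complex.ofReal_ne_zero.2 hδ), LinearIsometryEquiv.apply_symm_apply]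
  rw [hz, wind_loopCurve hδ β γ w]
  exact h.loopType_sign_mul_wind_nonneg w

/-- The unbased loop `[loopCurve δ β γ]` of an interface loop `γ` drawn on `δ e^{iβ} ℤ²` is a
member of the loop representation `bondLoopConfig δ β ω`, in the family of its type.
[cite: arXiv201211672v2, §1.2] -/
theorem IsInterfaceLoop.unbasedLoop_mem_bondLoopConfig (h : IsInterfaceLoop ω γ) (δ β : ℝ) :
    UnbasedLoop.mk (BasedLoop.mk (loopCurve δ β γ) (isLoop_loopCurve δ β h.ne_nil)) ∈
      (bondLoopConfig δ β ω).F (loopType γ) :=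
  ⟨γ, h, rfl, rfl⟩

/-- **The orientation lemma for typed interface loops.** If `γ`, `γ'` are interface loops of
the same type, `d(γ, γ') ≤ ε` for DKKMO's unoriented distance, and `γ` is fat at scale `ε`
(it winds around a point at distance `> ε` from its trace), then already the ORIENTED unbased
distance is `≤ ε`. [cite: arXiv201211672v2, §1.2] -/
theorem IsInterfaceLoop.dist_unbasedLoop_le_of_udist_le (h : IsInterfaceLoop ω γ)
    (h' : IsInterfaceLoop ω' γ') (ht : loopType γ' = loopType γ) {δ : ℝ} (hδ : δ ≠ 0) (β β' : ℝ)
    {ε : ℝ} (hd : (UnbasedLoop.mk (BasedLoop.mk (loopCurve δ β γ) (isLoop_loopCurve δ β h.ne_nil))).udist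
      (UnbasedLoop.mk (BasedLoop.mk (loopCurve δ β' γ') (isLoop_loopCurve δ β' h'.ne_nil))) ≤ ε)
    (hfat : ∃ z, ε < infDist z (loopCurve δ β γ).range ∧ (loopCurve δ β γ).wind z ≠ 0) :
    dist (UnbasedLoop.mk (BasedLoop.mk (loopCurve δ β γ) (isLoop_loopCurve δ β h.ne_nil)))
      (UnbasedLoop.mk (BasedLoop.mk (loopCurve δ β' γ') (isLoop_loopCurve δ β' h'.ne_nil))) ≤ ε := by
  refine UnbasedLoop.dist_le_of_udist_le (s := (![-1, 1] : Fin 2 → ℤ) (loopType γ)) hfat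
    (fun z ↦ h.loopType_sign_mul_wind_loopCurve_nonneg hδ β z) (fun z ↦ ?_) ?_ hd
  · rw [UnbasedLoop.wind_mk, BasedLoop.toCurveClass_mk, ← ht]
    exact h'.loopType_sign_mul_wind_loopCurve_nonneg hδ β' z
  · generalize loopType γ = i
    fin_cases i <;> simp

/-- **Partner loops of the same type wind equally away from the trace.** Let `γ` (of `ω`, on
`δe^{iβ}ℤ²`) and `γ'` (of `ω'`, on `δe^{iβ'}ℤ²`) be interface loops of the same type with
`d(γ, γ') ≤ ε` (the matching of `LoopConfig.IsClose`), and let `γ` be fat at scale `ε`. Then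
`W(γ', z) = W(γ, z)` for every `z` at distance `> ε` from the trace of `γ`: inside / outside
information passes between partner loops away from their traces. [cite: arXiv201211672v2, §1.2] -/
theorem IsInterfaceLoop.wind_eq_of_udist_le (h : IsInterfaceLoop ω γ) (h' : IsInterfaceLoop ω' γ')
    (ht : loopType γ' = loopType γ) {δ : ℝ} (hδ : δ ≠ 0) (β β' : ℝ) {ε : ℝ}
    (hd : (UnbasedLoop.mk (BasedLoop.mk (loopCurve δ β γ) (isLoop_loopCurve δ β h.ne_nil))).udist
      (UnbasedLoop.mk (BasedLoop.mk (loopCurve δ β' γ') (isLoop_loopCurve δ β' h'.ne_nil))) ≤ ε)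
    (hfat : ∃ z, ε < infDist z (loopCurve δ β γ).range ∧ (loopCurve δ β γ).wind z ≠ 0)
    {z : ℂ} (hz : ε < infDist z (loopCurve δ β γ).range) :
    (loopCurve δ β' γ').wind z = (loopCurve δ β γ).wind z := by
  have hdist := h.dist_unbasedLoop_le_of_udist_le h' ht hδ β β' hd hfat
  have := UnbasedLoop.wind_eq_of_dist_lt (u := UnbasedLoop.mk (BasedLoop.mk (loopCurve δ β γ) (isLoop_loopCurve δ β h.ne_nil)))
    (v := UnbasedLoop.mk (BasedLoop.mk (loopCurve δ β' γ') (isLoop_loopCurve δ β' h'.ne_nil))) (hdist.trans_lt hz)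
  simpa using this

/-- The same with the roles of inside-information made explicit: a point at distance `> ε` from
the trace of `γ` around which `γ` winds (`W ≠ 0`, "inside") is a point around which the partner
winds equally; a point with `W(γ, z) = 0` ("outside") has `W(γ', z) = 0`.
[cite: arXiv201211672v2, §1.2] -/
theorem IsInterfaceLoop.wind_eq_zero_iff_of_udist_le (h : IsInterfaceLoop ω γ) (h' : IsInterfaceLoop ω' γ')
    (ht : loopType γ' = loopType γ) {δ : ℝ} (hδ : δ ≠ 0) (β β' : ℝ) {ε : ℝ}
    (hd : (UnbasedLoop.mk (BasedLoop.mk (loopCurve δ β γ) (isLoop_loopCurve δ β h.ne_nil))).udist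
      (UnbasedLoop.mk (BasedLoop.mk (loopCurve δ β' γ') (isLoop_loopCurve δ β' h'.ne_nil))) ≤ ε)
    (hfat : ∃ z, ε < infDist z (loopCurve δ β γ).range ∧ (loopCurve δ β γ).wind z ≠ 0)
    {z : ℂ} (hz : ε < infDist z (loopCurve δ β γ).range) :
    (loopCurve δ β' γ').wind z = 0 ↔ (loopCurve δ β γ).wind z = 0 := by
  rw [h.wind_eq_of_udist_le h' ht hδ β β' hd hfat hz]

end Literature.Probability.Percolation

end
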